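/-
search for candidate a priori estimates; no regularity claim

# K73 — THE TOP DISCRIMINANT `D = (λ₁ − λ₂)(λ₁ − λ₃)` AND ITS CUTOFFS: canonical smooth cutoffs of
# the crossing set `{λ₂ = λ₁}` on `T³` (nogo g55; door (e) box; imports BUILT modules only)

Node: Lemma L-λ(q) = `TopEigHeatCoercivePos q` (OPEN for every real `q > 1`); door (b)/(F2) wants
`¬ TopEigHeatCoercivePos q` (WANTED/OPEN). This file decides nothing about the node. K72's local
inverse-gap rule (R19) bounds `∫ χλ₁`, for an ARBITRARY smooth cutoff `χ` vanishing near the crossing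
set, by `‖v‖_∞ ∫|∇χ| + ‖v‖_∞ √3 √(heat Φ_q v) √(∫ χ/w_q)`, `w_q = qλ₁^{q−1}(λ₁ − λ₂)`; this file supplies
the CANONICAL `χ` and the weight floor on its support.
§ 0 folklore: `tr(S²) = Σₖ λₖ²` (spectral theorem) and the sorted triple `λ₁ ≥ λ₂ ≥ λ₃` of `S(x)`.
§ 1 the TOP DISCRIMINANT `D := 3λ₁² − 2(tr S)λ₁ + ((tr S)² − Σᵢⱼ Sᵢⱼ²)/2` (a polynomial in the entries of
`S` and in `λ₁`: the derivative of the characteristic polynomial of `S` at `λ₁`), the Vieta identity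
`D = (λ₁ − λ₂)(λ₁ − λ₃)`, `0 ≤ D`, `0 < D ↔ λ₂ < λ₁`, `D = 0 ↔ λ₂ = λ₁`; `D` is continuous on `T³` and
CHART-SMOOTH AT EVERY POINT OF `U_s = {λ₂ < λ₁}` (as `λ₁` is; `λ₂`, `λ₃` need not be, `λ₂ = λ₃` may
happen inside `U_s`): a smooth defining function of the crossing set from inside `U_s`.
§ 2 the DISCRIMINANT CUTOFFS `χ_η := cutStep_{η²} ∘ D` (`η ≠ 0`; tree `TopEig.cutStep`): SMOOTH ON
`T³`, `0 ≤ χ_η ≤ 1`, `χ_η = 0` on `{D ≤ η²}` — so `χ_η = 0` NEAR EVERY POINT OF THE CROSSING SET, which is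
K72's cutoff hypothesis —, `χ_η = 1` on `{2η² ≤ D}`.
§ 3 WEIGHT FLOOR on the support (`v` divergence free): `D ≤ 3λ₁(λ₁ − λ₂)`, `D ≤ (9/4)λ₁²`; hence on
`{η² ≤ D}`: `λ₁ ≥ (2/3)η`, `w_q ≥ q((2/3)η)^{q−2}η²/3` (`q ≥ 2`), `w_q ≥ qΛ^{q−2}η²/3` (`0 ≤ q ≤ 2`,
`λ₁ ≤ Λ`), and `χ_η/w_q ≤ (q((2/3)η)^{q−2}η²/3)⁻¹` at every point (`q ≥ 2`).
COROLLARY (R20) — on paper here; in the kernel once K72's olean is built (it is (R19)/(R19₀) with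
`χ = χ_η`, § 2, § 3 and `|T³| = 1`): for `q ≥ 2`, `η > 0`, `v` smooth divergence free with `‖v‖ ≤ M`:
`∫_{D ≥ 2η²} λ₁ ≤ ∫ χ_η λ₁ ≤ M ∫|∇χ_η| + (3M/η) √(heatDissipation Φ_q v / (q((2/3)η)^{q−2}))`; and an
exact witness (`heatDissipation Φ_q v ≤ 0`, some `q > 1`) has `∫_{D ≥ 2η²} λ₁ ≤ M ∫|∇χ_η|` for every
`η > 0`: the `λ₁`-mass at discriminant level `≥ 2η²` of a killing / exact design is controlled by the
shell `{η² ≤ D ≤ 2η²}` (where `∇χ_η = η⁻² cutStep′(D/η²) ∇D` lives) plus `O(M η^{−q/2} √heat)`. Nothing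
is claimed about L-λ(q). [ours = this programme; folklore = spectral theorem, calculus on `T^d`]
FILING (prove seat g31, REQUEST #102): declarations byte-identical to the no-go seat's staged `TopEigHeatDiscCutoff.STAGING.lean` 094c5a4418766439; this line is the only addition.
-/
import Summits.NavierStokesRegularity.FunctionalMining.TopEigGapCutoffSmooth
import HarnessLib

noncomputable section

open Filter Topology Set Finset
open scoped ContDiff

namespace Summit.NavierStokesRegularity.FunctionalMining

open Literature.Analysis Literature.Analysis.FunctionSpaces Literature.Analysis.FunctionSpaces.Torus

namespace TopEig.DiscCutoff

variable {v : UnitAddTorus (Fin 3) → EuclideanSpace ℝ (Fin 3)} {q η Λ : ℝ} {x : UnitAddTorus (Fin 3)}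

/-! ## § 0 Folklore: `tr(S²) = Σₖ λₖ²` and the sorted triple -/

/-- `tr(M²) = Σᵢ λᵢ²` for a real symmetric matrix (spectral theorem). [folklore; the tree's
`ThreeWaveStrain.trace_mul_self_eq_sum_sq`, outside this file's import closure] -/
private theorem trace_mul_self_eq_sum_eig_sq {n : Type*} [Fintype n] [DecidableEq n] {M : Matrix n n ℝ}
    (hM : M.IsHermitian) : (M * M).trace = ∑ i, hM.eigenvalues i ^ 2 := by
  have hspec := hM.spectral_theorem
  set U := hM.eigenvectorUnitary with hU
  have h2 : M * M = (U : Matrix n n ℝ) * Matrix.diagonal (fun i => hM.eigenvalues i ^ 2) *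
      (star (U : Matrix n n ℝ)) := by
    have hD : Matrix.diagonal (RCLike.ofReal ∘ hM.eigenvalues : n → ℝ) =
        Matrix.diagonal hM.eigenvalues := by
      congr 1
    conv_lhs => rw [hspec]
    rw [Unitary.conjStarAlgAut_apply, hD]
    have hUU : (star (U : Matrix n n ℝ)) * (U : Matrix n n ℝ) = 1 := Unitary.coe_star_mul_self U
    calc (U : Matrix n n ℝ) * Matrix.diagonal hM.eigenvalues * star (U : Matrix n n ℝ) *
          ((U : Matrix n n ℝ) * Matrix.diagonal hM.eigenvalues * star (U : Matrix n n ℝ))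
        = (U : Matrix n n ℝ) * Matrix.diagonal hM.eigenvalues *
            ((star (U : Matrix n n ℝ)) * (U : Matrix n n ℝ)) * Matrix.diagonal hM.eigenvalues *
            star (U : Matrix n n ℝ) := by simp only [Matrix.mul_assoc]
      _ = (U : Matrix n n ℝ) * Matrix.diagonal (fun i => hM.eigenvalues i ^ 2) *
            star (U : Matrix n n ℝ) := by
          rw [hUU, Matrix.mul_one, Matrix.mul_assoc (U : Matrix n n ℝ), Matrix.diagonal_mul_diagonal]
          simp only [pow_two]
  rw [h2, Matrix.trace_mul_cycle, Unitary.coe_star_mul_self, Matrix.one_mul, Matrix.trace_diagonal]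

/-- `tr(M²) = Σᵢⱼ Mᵢⱼ²` for a symmetric matrix. [folklore] -/
private theorem trace_mul_self_eq_sum_entry_sq {n : Type*} [Fintype n] {M : Matrix n n ℝ}
    (hsym : M.IsSymm) : (M * M).trace = ∑ i, ∑ j, M i j ^ 2 := by
  simp only [Matrix.trace, Matrix.diag, Matrix.mul_apply]
  refine Finset.sum_congr rfl fun i _ => Finset.sum_congr rfl fun j _ => ?_
  rw [pow_two]
  congr 1
  exact (hsym.apply j i).symm

/-- **The sorted strain triple at `x`**: `λ₁ = μ 0 ≥ λ₂ = μ 1 ≥ λ₃ = μ 2`, `Σᵢ Sᵢᵢ = Σₖ μₖ`,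
`Σᵢⱼ Sᵢⱼ² = Σₖ μₖ²`. [folklore, bookkeeping; cf. tree `torusStrainMidEig_eq_eig_one`] -/
theorem exists_sortedTriple (v : UnitAddTorus (Fin 3) → EuclideanSpace ℝ (Fin 3)) (x : UnitAddTorus (Fin 3)) :
    ∃ μ : Fin 3 → ℝ, Antitone μ ∧ torusStrainTopEig v x = μ 0 ∧ torusStrainMidEig v x = μ 1 ∧
      torusStrainBotEig v x = μ 2 ∧ (∑ i, torusStrainMatrix v x i i) = ∑ k, μ k ∧
      (∑ i, ∑ j, torusStrainMatrix v x i j ^ 2) = ∑ k, μ k ^ 2 := by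
  have hd : Fintype.card (Fin 3) = 3 := Fintype.card_fin 3
  set e := torusStrainEig v x with he
  set μ : Fin 3 → ℝ := fun j => e (Fin.cast hd.symm j) with hμdef
  have hμ : Antitone μ := fun a b hab =>
    torusStrainEig_antitone v x (show Fin.cast hd.symm a ≤ Fin.cast hd.symm b by simpa using hab)
  have hsum1 : ∑ j, μ j = ∑ k, e k := Fintype.sum_equiv (finCongr hd.symm) μ e (fun j => rfl)
  have hsum2 : ∑ j, μ j ^ 2 = ∑ k, e k ^ 2 :=
    Fintype.sum_equiv (finCongr hd.symm) (fun j => μ j ^ 2) (fun k => e k ^ 2) (fun j => rfl)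
  haveI : Nonempty (Fin 3) := ⟨0⟩
  have htop : torusStrainTopEig v x = μ 0 := by
    unfold torusStrainTopEig
    rw [← he, ← (finCongr hd.symm).iSup_comp]
    change (⨆ j, μ j) = μ 0
    exact le_antisymm (ciSup_le fun j => hμ (Fin.zero_le j)) (le_ciSup (Set.finite_range μ).bddAbove 0)
  have hbot : torusStrainBotEig v x = μ 2 := by
    unfold torusStrainBotEig
    rw [← he, ← (finCongr hd.symm).iInf_comp]
    change (⨅ j, μ j) = μ 2
    exact le_antisymm (ciInf_le (Set.finite_range μ).bddBelow 2) (le_ciInf fun j => hμ (Fin.le_last j))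
  have htr : (∑ i, torusStrainMatrix v x i i) = ∑ k, μ k := by
    have h1 : (∑ i, torusStrainMatrix v x i i) = (torusStrainMatrix v x).trace := rfl
    rw [h1, ← sum_torusStrainEig, ← he, hsum1]
  have hsq : (∑ i, ∑ j, torusStrainMatrix v x i j ^ 2) = ∑ k, μ k ^ 2 := by
    have hH := torusStrainMatrix_isHermitian v x
    have h2 : (∑ i, hH.eigenvalues i ^ 2) = ∑ k, e k ^ 2 := by
      rw [he]
      exact Fintype.sum_equiv (Fintype.equivOfCardEq (Fintype.card_fin _)).symm
        (fun i => hH.eigenvalues i ^ 2) (fun k => torusStrainEig v x k ^ 2) (fun i => rfl)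
    rw [← trace_mul_self_eq_sum_entry_sq (torusStrainMatrix_isSymm v x), trace_mul_self_eq_sum_eig_sq hH,
      h2, hsum2]
  refine ⟨μ, hμ, htop, ?_, hbot, htr, hsq⟩
  unfold torusStrainMidEig
  rw [← he, ← hsum1, htop, hbot, Fin.sum_univ_three]
  ring

/-- `λ₂ ≤ λ₁` and `λ₃ ≤ λ₂` at every point. [folklore] -/
theorem botEig_le_midEig_le_topEig (v : UnitAddTorus (Fin 3) → EuclideanSpace ℝ (Fin 3))
    (x : UnitAddTorus (Fin 3)) :
    torusStrainBotEig v x ≤ torusStrainMidEig v x ∧ torusStrainMidEig v x ≤ torusStrainTopEig v x := by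
  obtain ⟨μ, hμ, h1, h2, h3, -, -⟩ := exists_sortedTriple v x
  rw [h1, h2, h3]
  exact ⟨hμ (show (1 : Fin 3) ≤ 2 by decide), hμ (show (0 : Fin 3) ≤ 1 by decide)⟩

/-! ## § 1 The top discriminant -/

/-- **The top discriminant** `D(x) := 3λ₁² − 2(tr S)λ₁ + ((tr S)² − Σᵢⱼ Sᵢⱼ²)/2`, a polynomial in the
entries of `S(x)` and in `λ₁(x)` (`= p′(λ₁)` for the characteristic polynomial `p` of `S(x)`);
`D = (λ₁ − λ₂)(λ₁ − λ₃)` (`topDisc_eq`). [ours] -/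
def topDisc (v : UnitAddTorus (Fin 3) → EuclideanSpace ℝ (Fin 3)) (x : UnitAddTorus (Fin 3)) : ℝ :=
  3 * torusStrainTopEig v x ^ 2 - 2 * (∑ i, torusStrainMatrix v x i i) * torusStrainTopEig v x +
    ((∑ i, torusStrainMatrix v x i i) ^ 2 - ∑ i, ∑ j, torusStrainMatrix v x i j ^ 2) / 2

/-- **`D = (λ₁ − λ₂)(λ₁ − λ₃)`** (Vieta). [ours; folklore algebra] -/
theorem topDisc_eq (v : UnitAddTorus (Fin 3) → EuclideanSpace ℝ (Fin 3)) (x : UnitAddTorus (Fin 3)) :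
    topDisc v x = (torusStrainTopEig v x - torusStrainMidEig v x) *
      (torusStrainTopEig v x - torusStrainBotEig v x) := by
  obtain ⟨μ, -, h1, h2, h3, htr, hsq⟩ := exists_sortedTriple v x
  simp only [topDisc]
  rw [hsq, htr, h1, h2, h3]
  simp only [Fin.sum_univ_three]
  ring

/-- `0 ≤ D`. [ours] -/
theorem topDisc_nonneg (v : UnitAddTorus (Fin 3) → EuclideanSpace ℝ (Fin 3)) (x : UnitAddTorus (Fin 3)) :
    0 ≤ topDisc v x := by
  obtain ⟨h32, h21⟩ := botEig_le_midEig_le_topEig v x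
  rw [topDisc_eq]
  exact mul_nonneg (by linarith) (by linarith)

/-- **`0 < D ↔ λ₂ < λ₁`**: `{D > 0}` is the simple set `U_s`. [ours] -/
theorem topDisc_pos_iff : 0 < topDisc v x ↔ torusStrainMidEig v x < torusStrainTopEig v x := by
  obtain ⟨h32, h21⟩ := botEig_le_midEig_le_topEig v x
  rw [topDisc_eq]
  refine ⟨fun h => ?_, fun h => mul_pos (sub_pos.2 h) (by linarith)⟩
  by_contra hle
  have h0 : torusStrainTopEig v x - torusStrainMidEig v x = 0 := by linarith [not_lt.1 hle]
  rw [h0, zero_mul] at h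
  exact lt_irrefl _ h

/-- **`D = 0 ↔ λ₂ = λ₁`**: the zero set of `D` is the crossing set. [ours] -/
theorem topDisc_eq_zero_iff : topDisc v x = 0 ↔ torusStrainMidEig v x = torusStrainTopEig v x := by
  have h0 := topDisc_nonneg v x
  have h21 := (botEig_le_midEig_le_topEig v x).2
  have hp := topDisc_pos_iff (v := v) (x := x)
  refine ⟨fun h => le_antisymm h21 (not_lt.1 fun hlt => ?_), fun h => ?_⟩
  · have := hp.2 hlt
    linarith
  · have hn : ¬ 0 < topDisc v x := fun hq => by have := hp.1 hq; linarith
    linarith [not_lt.1 hn]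

/-- `D = 0` at every non-simple point. [ours, bookkeeping] -/
theorem topDisc_eq_zero_of_not_lt (hx : ¬ torusStrainMidEig v x < torusStrainTopEig v x) : topDisc v x = 0 :=
  topDisc_eq_zero_iff.2 (le_antisymm (botEig_le_midEig_le_topEig v x).2 (not_lt.1 hx))

/-- **`D` is continuous on `T³`.** [ours] -/
theorem continuous_topDisc (hv : Torus.IsSmooth v) : Continuous (topDisc v) := by
  have hl := continuous_torusStrainTopEig hv
  have hS : ∀ i j, Continuous fun y => torusStrainMatrix v y i j := fun i j =>
    (isSmooth_torusStrainMatrix_entry hv i j).continuous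
  have hT : Continuous fun y => ∑ i, torusStrainMatrix v y i i := continuous_finsetSum _ fun i _ => hS i i
  have hF : Continuous fun y => ∑ i, ∑ j, torusStrainMatrix v y i j ^ 2 :=
    continuous_finsetSum _ fun i _ => continuous_finsetSum _ fun j _ => (hS i j).pow 2
  unfold topDisc
  exact ((continuous_const.mul (hl.pow 2)).sub ((continuous_const.mul hT).mul hl)).add
    (((hT.pow 2).sub hF).div_const 2)

/-- **`D` is chart-smooth at every point of `U_s`** (`λ₁` is, tree
`contDiffAt_liftAt_torusStrainTopEig_of_midEig_lt`; the entries of `S` are smooth). [ours] -/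
theorem contDiffAt_liftAt_topDisc (hv : Torus.IsSmooth v)
    (hx : torusStrainMidEig v x < torusStrainTopEig v x) : ContDiffAt ℝ ∞ (liftAt (topDisc v) x) 0 := by
  have hl : ContDiffAt ℝ ∞ (liftAt (torusStrainTopEig v) x) 0 :=
    contDiffAt_liftAt_torusStrainTopEig_of_midEig_lt hv hx
  have hS : ∀ i j, ContDiffAt ℝ ∞ (liftAt (fun y => torusStrainMatrix v y i j) x) 0 := fun i j =>
    ((isSmooth_torusStrainMatrix_entry hv i j).liftAt x).contDiffAt
  have hT : ContDiffAt ℝ ∞ (fun w => ∑ i, liftAt (fun y => torusStrainMatrix v y i i) x w) 0 :=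
    ContDiffAt.sum fun i _ => hS i i
  have hF : ContDiffAt ℝ ∞ (fun w => ∑ i, ∑ j, liftAt (fun y => torusStrainMatrix v y i j) x w ^ 2) 0 :=
    ContDiffAt.sum fun i _ => ContDiffAt.sum fun j _ => (hS i j).pow 2
  have hfun : liftAt (topDisc v) x = fun w => 3 * liftAt (torusStrainTopEig v) x w ^ 2 -
      2 * (∑ i, liftAt (fun y => torusStrainMatrix v y i i) x w) * liftAt (torusStrainTopEig v) x w +
      ((∑ i, liftAt (fun y => torusStrainMatrix v y i i) x w) ^ 2 -
        ∑ i, ∑ j, liftAt (fun y => torusStrainMatrix v y i j) x w ^ 2) / 2 := by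
    funext w
    rfl
  rw [hfun]
  exact ((contDiffAt_const.mul (hl.pow 2)).sub ((contDiffAt_const.mul hT).mul hl)).add
    (((hT.pow 2).sub hF).div_const 2)

/-! ## § 2 The discriminant cutoffs `χ_η = cutStep_{η²} ∘ D` -/

/-- **The discriminant cutoff** `χ_η(x) := cutStep_{η²}(D(x))`: `0` where `D ≤ η²`, `1` where `D ≥ 2η²`,
smooth in between (tree `TopEig.cutStep`). [ours] -/
def discCutoff (η : ℝ) (v : UnitAddTorus (Fin 3) → EuclideanSpace ℝ (Fin 3)) (x : UnitAddTorus (Fin 3)) : ℝ :=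
  cutStep (η ^ 2) (topDisc v x)

/-- `0 ≤ χ_η`. [ours, bookkeeping] -/
theorem discCutoff_nonneg : 0 ≤ discCutoff η v x := cutStep_nonneg _ _

/-- `χ_η ≤ 1`. [ours, bookkeeping] -/
theorem discCutoff_le_one : discCutoff η v x ≤ 1 := cutStep_le_one _ _

/-- `χ_η = 0` on `{D ≤ η²}`. [ours] -/
theorem discCutoff_eq_zero (hη : η ≠ 0) (h : topDisc v x ≤ η ^ 2) : discCutoff η v x = 0 :=
  cutStep_of_le (by positivity) h

/-- `χ_η = 1` on `{2η² ≤ D}`. [ours] -/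
theorem discCutoff_eq_one (hη : η ≠ 0) (h : 2 * η ^ 2 ≤ topDisc v x) : discCutoff η v x = 1 :=
  cutStep_of_ge (by positivity) h

/-- The support of `χ_η` lies in `{η² < D}` (in particular inside `U_s`, with `λ₂ < λ₁`). [ours] -/
theorem sq_lt_topDisc_of_discCutoff_ne_zero (hη : η ≠ 0) (h : discCutoff η v x ≠ 0) : η ^ 2 < topDisc v x :=
  not_le.1 fun hle => h (discCutoff_eq_zero hη hle)

/-- **`χ_η` vanishes near every point of the crossing set** (K72's cutoff hypothesis): `D` is continuous
and `D = 0 < η²` there. [ours] -/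
theorem discCutoff_eventuallyEq_zero (hv : Torus.IsSmooth v) (hη : η ≠ 0)
    (hx : ¬ torusStrainMidEig v x < torusStrainTopEig v x) : discCutoff η v =ᶠ[𝓝 x] fun _ => 0 := by
  have h0 : topDisc v x = 0 := topDisc_eq_zero_of_not_lt hx
  have hlt : ∀ᶠ y in 𝓝 x, topDisc v y < η ^ 2 :=
    (continuous_topDisc hv).continuousAt.eventually_lt continuousAt_const (by rw [h0]; positivity)
  filter_upwards [hlt] with y hy
  exact discCutoff_eq_zero hη hy.le

/-- **`χ_η` is smooth on `T³`**: a smooth function of the chart-smooth `D` on `U_s`, identically `0` near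
every point of the crossing set. [ours] -/
theorem isSmooth_discCutoff (hv : Torus.IsSmooth v) (hη : η ≠ 0) : Torus.IsSmooth (discCutoff η v) := by
  unfold Torus.IsSmooth
  rw [← liftAt_zero_left]
  refine contDiff_iff_contDiffAt.2 fun w => ?_
  by_cases hx : torusStrainMidEig v ((0 : UnitAddTorus (Fin 3)) + proj w) <
      torusStrainTopEig v ((0 : UnitAddTorus (Fin 3)) + proj w)
  · have h1 : ContDiffAt ℝ ∞ (liftAt (topDisc v) 0) w :=
      contDiffAt_liftAt_of_shift (contDiffAt_liftAt_topDisc hv hx)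
    have hfun : liftAt (discCutoff η v) 0 = cutStep (η ^ 2) ∘ liftAt (topDisc v) 0 := rfl
    rw [hfun]
    exact (contDiff_cutStep _).contDiffAt.comp w h1
  · have ht : Tendsto (fun w' : EuclideanSpace ℝ (Fin 3) => (0 : UnitAddTorus (Fin 3)) + proj w') (𝓝 w)
        (𝓝 ((0 : UnitAddTorus (Fin 3)) + proj w)) := (continuous_const.add continuous_proj).continuousAt
    have hEq : liftAt (discCutoff η v) 0 =ᶠ[𝓝 w] fun _ => (0 : ℝ) := by
      filter_upwards [ht.eventually (discCutoff_eventuallyEq_zero hv hη hx)] with w' hw'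
      simpa only [liftAt_apply] using hw'
    exact contDiffAt_const.congr_of_eventuallyEq hEq

/-! ## § 3 Weight floor on the support (divergence-free fields) -/

/-- `Σᵢ Sᵢᵢ = 0` for a divergence-free field. [folklore] -/
private theorem strain_sum_diag_eq_zero (hv : Torus.IsSmooth v) (hdv : Torus.IsDivFree v)
    (x : UnitAddTorus (Fin 3)) : (∑ i, torusStrainMatrix v x i i) = 0 :=
  torusStrainMatrix_trace_eq_zero hv hdv x

/-- `0 ≤ λ₁` for a divergence-free field (`3λ₁ ≥ λ₁ + λ₂ + λ₃ = 0`). [folklore] -/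
theorem topEig_nonneg_of_isDivFree (hv : Torus.IsSmooth v) (hdv : Torus.IsDivFree v)
    (x : UnitAddTorus (Fin 3)) : 0 ≤ torusStrainTopEig v x := by
  obtain ⟨μ, hμ, h1, -, -, htr, -⟩ := exists_sortedTriple v x
  have h0 : μ 0 + μ 1 + μ 2 = 0 := by
    have h := strain_sum_diag_eq_zero hv hdv x
    rwa [htr, Fin.sum_univ_three] at h
  have h10 : μ 1 ≤ μ 0 := hμ (show (0 : Fin 3) ≤ 1 by decide)
  have h21 : μ 2 ≤ μ 1 := hμ (show (1 : Fin 3) ≤ 2 by decide)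
  rw [h1]
  linarith

/-- **`D ≤ 3λ₁(λ₁ − λ₂)`** for a divergence-free field (`λ₁ − λ₃ ≤ 3λ₁`). [ours] -/
theorem topDisc_le_three_mul (hv : Torus.IsSmooth v) (hdv : Torus.IsDivFree v) (x : UnitAddTorus (Fin 3)) :
    topDisc v x ≤ 3 * torusStrainTopEig v x * (torusStrainTopEig v x - torusStrainMidEig v x) := by
  obtain ⟨μ, hμ, h1, h2, h3, htr, -⟩ := exists_sortedTriple v x
  have h0 : μ 0 + μ 1 + μ 2 = 0 := by
    have h := strain_sum_diag_eq_zero hv hdv x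
    rwa [htr, Fin.sum_univ_three] at h
  have h10 : μ 1 ≤ μ 0 := hμ (show (0 : Fin 3) ≤ 1 by decide)
  rw [topDisc_eq, h1, h2, h3]
  have hkey : (μ 0 - μ 1) * (μ 0 - μ 2) - 3 * μ 0 * (μ 0 - μ 1) = -((μ 0 - μ 1) ^ 2) := by
    rw [show μ 2 = -μ 0 - μ 1 by linarith]
    ring
  nlinarith [sq_nonneg (μ 0 - μ 1)]

/-- **`D ≤ (9/4)λ₁²`** for a divergence-free field (equality iff `λ₂ = λ₃`: uniaxial extension). [ours] -/
theorem topDisc_le_topEig_sq (hv : Torus.IsSmooth v) (hdv : Torus.IsDivFree v) (x : UnitAddTorus (Fin 3)) :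
    topDisc v x ≤ 9 / 4 * torusStrainTopEig v x ^ 2 := by
  obtain ⟨μ, -, h1, h2, h3, htr, -⟩ := exists_sortedTriple v x
  have h0 : μ 0 + μ 1 + μ 2 = 0 := by
    have h := strain_sum_diag_eq_zero hv hdv x
    rwa [htr, Fin.sum_univ_three] at h
  rw [topDisc_eq, h1, h2, h3, show μ 2 = -μ 0 - μ 1 by linarith]
  nlinarith [sq_nonneg (μ 1 + μ 0 / 2)]

/-- **`λ₁ ≥ (2/3)η` on `{η² ≤ D}`** (divergence free). [ours] -/
theorem le_topEig_of_sq_le_topDisc (hv : Torus.IsSmooth v) (hdv : Torus.IsDivFree v) (hη : 0 ≤ η)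
    (h : η ^ 2 ≤ topDisc v x) : 2 / 3 * η ≤ torusStrainTopEig v x := by
  have hl0 := topEig_nonneg_of_isDivFree hv hdv x
  have h9 := topDisc_le_topEig_sq hv hdv x
  have hs : (2 / 3 * η) ^ 2 ≤ torusStrainTopEig v x ^ 2 := by nlinarith
  calc 2 / 3 * η = Real.sqrt ((2 / 3 * η) ^ 2) := (Real.sqrt_sq (by positivity)).symm
    _ ≤ Real.sqrt (torusStrainTopEig v x ^ 2) := Real.sqrt_le_sqrt hs
    _ = torusStrainTopEig v x := Real.sqrt_sq hl0

/-- Core of the weight floors: `q m η²/3 ≤ w_q` on `{η² ≤ D}` whenever `m ≤ λ₁^{q−2}`. [ours] -/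
private theorem discWeight_floor_aux (hq0 : 0 ≤ q) (hv : Torus.IsSmooth v) (hdv : Torus.IsDivFree v)
    (hη : 0 < η) (h : η ^ 2 ≤ topDisc v x) {m : ℝ} (hA : m ≤ torusStrainTopEig v x ^ (q - 2)) :
    q * m * (η ^ 2 / 3) ≤
      q * torusStrainTopEig v x ^ (q - 1) * (torusStrainTopEig v x - torusStrainMidEig v x) := by
  have hb : 2 / 3 * η ≤ torusStrainTopEig v x := le_topEig_of_sq_le_topDisc hv hdv hη.le h
  have hl : 0 < torusStrainTopEig v x := lt_of_lt_of_le (by positivity) hb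
  have hA0 : 0 ≤ torusStrainTopEig v x ^ (q - 2) := Real.rpow_nonneg hl.le _
  have hC : η ^ 2 / 3 ≤ torusStrainTopEig v x * (torusStrainTopEig v x - torusStrainMidEig v x) := by
    have := topDisc_le_three_mul hv hdv x
    linarith
  have hsplit :
      torusStrainTopEig v x ^ (q - 1) = torusStrainTopEig v x ^ (q - 2) * torusStrainTopEig v x := by
    rw [show q - 1 = (q - 2) + 1 by ring, Real.rpow_add hl, Real.rpow_one]
  calc q * m * (η ^ 2 / 3) ≤ q * torusStrainTopEig v x ^ (q - 2) * (η ^ 2 / 3) :=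
        mul_le_mul_of_nonneg_right (mul_le_mul_of_nonneg_left hA hq0) (by positivity)
    _ ≤ q * torusStrainTopEig v x ^ (q - 2) *
          (torusStrainTopEig v x * (torusStrainTopEig v x - torusStrainMidEig v x)) :=
        mul_le_mul_of_nonneg_left hC (mul_nonneg hq0 hA0)
    _ = q * torusStrainTopEig v x ^ (q - 1) * (torusStrainTopEig v x - torusStrainMidEig v x) := by
        rw [hsplit]
        ring

/-- **WEIGHT FLOOR, `q ≥ 2`:** on `{η² ≤ D}`, `w_q = qλ₁^{q−1}(λ₁ − λ₂) ≥ q((2/3)η)^{q−2} · η²/3`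
(divergence free, `η > 0`). [ours] -/
theorem discWeight_floor_of_two_le (hq : 2 ≤ q) (hv : Torus.IsSmooth v) (hdv : Torus.IsDivFree v) (hη : 0 < η)
    (h : η ^ 2 ≤ topDisc v x) :
    q * (2 / 3 * η) ^ (q - 2) * (η ^ 2 / 3) ≤
      q * torusStrainTopEig v x ^ (q - 1) * (torusStrainTopEig v x - torusStrainMidEig v x) :=
  discWeight_floor_aux (by linarith) hv hdv hη h
    (Real.rpow_le_rpow (by positivity) (le_topEig_of_sq_le_topDisc hv hdv hη.le h) (by linarith))

/-- **WEIGHT FLOOR, `0 ≤ q ≤ 2`:** on `{η² ≤ D}`, `w_q ≥ qΛ^{q−2} · η²/3` when `λ₁ ≤ Λ` (divergence free,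
`η > 0`; `λ₁^{q−2}` is antitone in `λ₁` for `q ≤ 2`). [ours] -/
theorem discWeight_floor_of_le_two (hq0 : 0 ≤ q) (hq : q ≤ 2) (hv : Torus.IsSmooth v)
    (hdv : Torus.IsDivFree v) (hη : 0 < η) (h : η ^ 2 ≤ topDisc v x) (hΛ : torusStrainTopEig v x ≤ Λ) :
    q * Λ ^ (q - 2) * (η ^ 2 / 3) ≤
      q * torusStrainTopEig v x ^ (q - 1) * (torusStrainTopEig v x - torusStrainMidEig v x) :=
  have hl : 0 < torusStrainTopEig v x :=
    lt_of_lt_of_le (by positivity : 0 < 2 / 3 * η) (le_topEig_of_sq_le_topDisc hv hdv hη.le h)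
  discWeight_floor_aux hq0 hv hdv hη h (Real.rpow_le_rpow_of_nonpos hl hΛ (by linarith))

/-- **INVERSE-WEIGHT CEILING on the support of `χ_η`, `q ≥ 2`** (the last factor of (R19)): at every
point, `χ_η · w_q⁻¹ ≤ (q((2/3)η)^{q−2}η²/3)⁻¹` (divergence free, `η > 0`). [ours] -/
theorem discCutoff_mul_inv_weight_le (hq : 2 ≤ q) (hv : Torus.IsSmooth v) (hdv : Torus.IsDivFree v)
    (hη : 0 < η) (x : UnitAddTorus (Fin 3)) :
    discCutoff η v x * (q * torusStrainTopEig v x ^ (q - 1) *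
        (torusStrainTopEig v x - torusStrainMidEig v x))⁻¹ ≤
      (q * (2 / 3 * η) ^ (q - 2) * (η ^ 2 / 3))⁻¹ := by
  have hm : 0 < q * (2 / 3 * η) ^ (q - 2) * (η ^ 2 / 3) := by
    have : 0 < (2 / 3 * η) ^ (q - 2) := Real.rpow_pos_of_pos (by positivity) _
    have hq0 : 0 < q := by linarith
    positivity
  by_cases h0 : discCutoff η v x = 0
  · rw [h0, zero_mul]
    exact (inv_pos.2 hm).le
  · have hw := discWeight_floor_of_two_le hq hv hdv hη (sq_lt_topDisc_of_discCutoff_ne_zero hη.ne' h0).le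
    calc discCutoff η v x * (q * torusStrainTopEig v x ^ (q - 1) *
            (torusStrainTopEig v x - torusStrainMidEig v x))⁻¹
        ≤ 1 * (q * torusStrainTopEig v x ^ (q - 1) * (torusStrainTopEig v x - torusStrainMidEig v x))⁻¹ :=
          mul_le_mul_of_nonneg_right discCutoff_le_one (inv_pos.2 (hm.trans_le hw)).le
      _ ≤ (q * (2 / 3 * η) ^ (q - 2) * (η ^ 2 / 3))⁻¹ := by
          rw [one_mul]
          exact inv_anti₀ hm hw

end TopEig.DiscCutoff

end Summit.NavierStokesRegularity.FunctionalMining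

end
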